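/-
Copyright (c) 2026 the pub-hodgecm-mathlib formalisation cell (harness21).  Prover seat hodgecm-mathlib-K2E1-p08 (g4), Track B ∕ K2-LIT, h413 =
`stmt-HodgeConjecture-24833`, line `K2_E1_TraceFormulaBeta`, campaign «EIS-RANK-ONE» rung R2 «Godement»; DEAL «EIS-U3-GODEMENT» of the dealer K2E1-plan (g3)
2026-09-04T04:19:39Z ∕ ruling R-EIS-1: THE CLOSING FILE — Godement's criterion for `U(Φ₃)` over a CM field, UNCONDITIONAL (E5 ★ p857444 K2E4-p11 (g3) plugged into ★ (G2)).
-/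
import Summits.HodgeConjecture.HodgeConjecture.Theorems.K2E1BorelParabolicReductionU     -- ★ p857450 (G2) (this seat): E5 ⟹ E4 ⟹ Summable, end-to-end modulo E5
import Summits.HodgeConjecture.HodgeConjecture.Theorems.K2E1BorelEisensteinGodementU3    -- ★ p857434 (G′) (this seat): the `flatSectionU` comparison lemmas
import Summits.HodgeConjecture.HodgeConjecture.Theorems.K2E1BorelParabolicIntegralU3    -- ★ p857444 (K2E4-p11 (g3)): E5 `parabolicIntegral_borel_three` for `τ > 2`
import HarnessLib

/-!
# K2·E1 — `K2E1BorelEisensteinGodementCMThree`: GODEMENT'S CRITERION FOR `U(2,1)` — THE BOREL EISENSTEIN SERIES `E(f_z)(g) = Σ_{γ ∈ B(F)∖G(F)} φ(γg) H(γg)^z` OF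
# `U(J₃)` CONVERGES ABSOLUTELY, LOCALLY UNIFORMLY IN `g`, FOR `Re z > 2` (`Re s > 1`) — UNCONDITIONAL (campaign EIS-RANK-ONE, rung R2 closed at `N = 3`)

Track B ∕ K2-LIT, crux h413 = `stmt-HodgeConjecture-24833`, route of record `HCCMUnconditional`; cell `hodgecm-mathlib`, squad K2, ENGINE E1.  Prover seat
`hodgecm-mathlib-K2E1-p08` (g4); DEAL «EIS-U3-GODEMENT» (K2E1-plan (g3) 04:19:39Z; ruling R-EIS-1 04:25:41Z; split 04:38:21Z).  THEOREMS ONLY (no `def`, no `instance`, no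
notation, no named-fact hypothesis, no `sorry`); lane `--kind proof --supports stmt-HodgeConjecture-24833 --as helper` (count-neutral).

THE CHAIN (all ★): (G0) `K2E1GodementCount` (Godement's count, generic) → (G) `K2E1BorelEisensteinGodementU` (smear, ceiling, section; E4 ⟹ Summable) → (G2)
`K2E1BorelParabolicReductionU` (E5 ⟹ E4, end-to-end modulo E5) ← (G3) `K2E1BorelParabolicIntegralU3.parabolicIntegral_borel_three` (E5 for `τ > 2`, K2E4-p11 (g3)).  This
file is the one `exact`: for a quadratic `E ∕ F` with involution `c` (`[E:F] = 2`, `c² = 1`, `c ≠ 1`) and the Iwasawa decomposition (★ at every CM pair), and in particular for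
THE CM PAIR `(L⁺, L, c)` with NO hypothesis left:
* `summable_borelHeight_rpow_three` — `hIw → 2 < τ → ∀ g, Summable (q ↦ H(γ̃_q g)^τ)` (any quadratic `(F, E, c)`);
* **`summable_borelHeight_rpow_cm_three (L) (hτ : 2 < τ) : ∀ g, Summable (q ↦ H(γ̃_q g)^τ)`**;
* **`summable_eisensteinSeriesU_flatSectionU_cm_three (L) (hz : 2 < z.re) (hφ : ∀ x, ‖φ x‖ ≤ M) : ∀ g, Summable (q ↦ ‖flatSectionU φ z (γ̃_q * g)‖)`** — the norms of the
  terms of `eisensteinSeriesU (flatSectionU φ z) g` (★ `eisensteinSeriesU_flatSectionU`): GODEMENT'S CRITERION [MW1995 II.1.5 Prop.; Godement1964 §8; Garrett2018 Cor. 3.10.2] for the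
  Borel Eisenstein series of `U(Φ₃)` with a bounded (e.g. `K`-finite, continuous on the compact `B(F)N(𝔸)∖…`) coefficient `φ`, on Godement's half-plane `Re z > 2 = 2ρ_H`
  (`z = s + 1`: `Re s > 1`);
* **`exists_locallyUniform_majorant_flatSectionU_cm_three (L) (hz) (hφ) : ∀ g₀, ∃ U ∈ 𝓝 g₀, ∃ u, Summable u ∧ ∀ g ∈ U, ∀ q, ‖flatSectionU φ z (γ̃_q * g)‖ ≤ u q`** — the
  R4a majorant shape (continuity in `g`; with the `z`-uniform version of the same proof, holomorphy in `z` — ★ `K2E1EisensteinSeriesRegularity`).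
No measure appears in the statements: a Haar measure on `U(J₃)(𝔸)` and its Borel σ-algebra are chosen inside the proofs (`borel`, Mathlib `Measure.haar`).
HONEST LABEL: HC_CM is proved only modulo the 7 printed citations (2 remaining named inputs: hLiu418 = `stmt-HodgeConjecture-24832`, h413 = `stmt-HodgeConjecture-24833`) until rung 0
closes; count-neutral helper, proves no printed statement, closes no socket.
References: [Godement1964] R. Godement, Sém. Bourbaki 257, §8 · [MoeglinWaldspurger1995] C. Mœglin, J.-L. Waldspurger, *Spectral Decomposition and Eisenstein Series* (1995), II.1.5
Prop. · [Garrett2018] P. Garrett, *Modern Analysis of Automorphic Forms by Example* (2018), §3.10 Cor. 3.10.2 · [Rogawski1990] J. D. Rogawski, *Automorphic Representations of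
Unitary Groups in Three Variables* (1990), §2.2.
-/

set_option autoImplicit false
-- the mandated namespace repeats the single-problem summit's segment (`HodgeConjecture.HodgeConjecture`)
set_option linter.dupNamespace false

noncomputable section

open MeasureTheory MeasureTheory.Measure Set Filter Topology MulAction NumberField IsDedekindDomain
open scoped ENNReal NNReal Pointwise MatrixGroups
open Literature.MeasureTheory.Group
open Literature.NumberTheory.Automorphic Literature.NumberTheory.Automorphic.UnitaryGroup
open Summit.HodgeConjecture.HodgeConjecture.Cruxes.H413.K2E1BorelEisensteinU
open Summit.HodgeConjecture.HodgeConjecture.Cruxes.H413.K2E1BorelEisensteinGodementU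
open Summit.HodgeConjecture.HodgeConjecture.Cruxes.H413.K2E1BorelEisensteinGodementU3
open Summit.HodgeConjecture.HodgeConjecture.Cruxes.H413.K2E1BorelParabolicReductionU
open Summit.HodgeConjecture.HodgeConjecture.Cruxes.H413.K2E1BorelParabolicIntegralU3

namespace Summit.HodgeConjecture.HodgeConjecture.Cruxes.H413.K2E1BorelEisensteinGodementCMThree

/-! ## §1 Any quadratic `(F, E, c)` with the Iwasawa decomposition -/

section Quadratic

variable {F E : Type} [Field F] [NumberField F] [Field E] [NumberField E] [Algebra F E] {c : E ≃ₐ[F] E}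

/-- **GODEMENT FOR `U(J₃)`, any quadratic `E ∕ F` with involution `c`, given Iwasawa**: `2 < τ ⟹ ∀ g, Summable (q ↦ H(γ̃_q g)^τ)` — ★ (G2) `summable_borelHeight_rpow_of_parabolicIntegral`
at E5 = ★ (G3) `parabolicIntegral_borel_three`; the Haar measure is chosen inside. [cite: Godement1964, §8] [cite: MoeglinWaldspurger1995, II.1.5] [cite: Garrett2018, §3.10 (Cor. 3.10.2)] -/
theorem summable_borelHeight_rpow_three (h2 : Module.finrank F E = 2) (hc : c * c = 1) (hc1 : c ≠ 1)
    (hIw : ∀ g : (quasiSplit F E c 3).Adelic, ∃ b ∈ borelAdelic F E c 3, ∃ k : (quasiSplit F E c 3).Adelic,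
      adelicVal F E c 3 ((StdForm.antidiagonal 3).over E) k ∈ standardMaximalCompactGL 3 E ∧ g = b * k)
    {τ : ℝ} (hτ : 2 < τ) :
    ∀ g : (quasiSplit F E c 3).Adelic,
      Summable fun q : Quotient (orbitRel ↥(borelU (c : E →+* E) ((StdForm.antidiagonal 3).over E)) ↥(unitaryGroupOfForm (c : E →+* E) ((StdForm.antidiagonal 3).over E))) =>
        ((borelHeight ((quasiSplit F E c 3).toAdelic (Quotient.out q : ↥(unitaryGroupOfForm (c : E →+* E) ((StdForm.antidiagonal 3).over E))) * g) : ℝ)) ^ τ := by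
  letI : MeasurableSpace (quasiSplit F E c 3).Adelic := borel _
  haveI : BorelSpace (quasiSplit F E c 3).Adelic := ⟨rfl⟩
  haveI : T2Space (quasiSplit F E c 3).Adelic := inferInstanceAs (T2Space (adelic F E c 3 ((StdForm.antidiagonal 3).over E)))
  haveI : LocallyCompactSpace (quasiSplit F E c 3).Adelic := inferInstanceAs (LocallyCompactSpace (adelic F E c 3 ((StdForm.antidiagonal 3).over E)))
  exact summable_borelHeight_rpow_of_parabolicIntegral (Measure.haar) hIw (fun g => ⟨_, fun γ => borelHeight_toAdelic_mul_le_max_three γ g⟩)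
    (zero_le_two.trans hτ.le) (parabolicIntegral_borel_three h2 hc hc1 hτ)

/-- The same with the locally uniform majorant (R4a shape on heights). [cite: Garrett2018, §3.10 (Cor. 3.10.2)] [cite: MoeglinWaldspurger1995, II.1.5] -/
theorem exists_nhds_summable_majorant_borelHeight_rpow_three' (h2 : Module.finrank F E = 2) (hc : c * c = 1) (hc1 : c ≠ 1)
    (hIw : ∀ g : (quasiSplit F E c 3).Adelic, ∃ b ∈ borelAdelic F E c 3, ∃ k : (quasiSplit F E c 3).Adelic,
      adelicVal F E c 3 ((StdForm.antidiagonal 3).over E) k ∈ standardMaximalCompactGL 3 E ∧ g = b * k)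
    {τ : ℝ} (hτ : 2 < τ) (g₀ : (quasiSplit F E c 3).Adelic) :
    ∃ U ∈ 𝓝 g₀, ∃ u : Quotient (orbitRel ↥(borelU (c : E →+* E) ((StdForm.antidiagonal 3).over E)) ↥(unitaryGroupOfForm (c : E →+* E) ((StdForm.antidiagonal 3).over E))) → ℝ,
      Summable u ∧ ∀ g ∈ U, ∀ q,
        ((borelHeight ((quasiSplit F E c 3).toAdelic (Quotient.out q : ↥(unitaryGroupOfForm (c : E →+* E) ((StdForm.antidiagonal 3).over E))) * g) : ℝ)) ^ τ ≤ u q := by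
  letI : MeasurableSpace (quasiSplit F E c 3).Adelic := borel _
  haveI : BorelSpace (quasiSplit F E c 3).Adelic := ⟨rfl⟩
  haveI : T2Space (quasiSplit F E c 3).Adelic := inferInstanceAs (T2Space (adelic F E c 3 ((StdForm.antidiagonal 3).over E)))
  haveI : LocallyCompactSpace (quasiSplit F E c 3).Adelic := inferInstanceAs (LocallyCompactSpace (adelic F E c 3 ((StdForm.antidiagonal 3).over E)))
  exact exists_nhds_summable_majorant_borelHeight_rpow_of_parabolicIntegral (Measure.haar) hIw (fun g => ⟨_, fun γ => borelHeight_toAdelic_mul_le_max_three γ g⟩)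
    (zero_le_two.trans hτ.le) (parabolicIntegral_borel_three h2 hc hc1 hτ) g₀

end Quadratic

/-! ## §2 The CM pair `(L⁺, L, c)`: no hypothesis left -/

section CM

variable (L : Type) [Field L] [NumberField L] [IsCMField L]

/-- **GODEMENT FOR `U(Φ₃)` OVER A CM FIELD — `Σ_{q ∈ B(L⁺)∖U(J₃)(L⁺)} H(γ̃_q g)^τ < ∞` for every `τ > 2` and every `g`**, unconditionally (Iwasawa ★ CM, `[L : L⁺] = 2` Mathlib, `c² = 1`,
`c ≠ 1` Mathlib). [cite: Godement1964, §8] [cite: MoeglinWaldspurger1995, II.1.5] [cite: Garrett2018, §3.10 (Cor. 3.10.2)] [cite: Rogawski1990, §2.2] -/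
theorem summable_borelHeight_rpow_cm_three {τ : ℝ} (hτ : 2 < τ) :
    ∀ g : (quasiSplit (↥(maximalRealSubfield L)) L (IsCMField.complexConj L) 3).Adelic,
      Summable fun q : Quotient (orbitRel ↥(borelU ((IsCMField.complexConj L : L ≃ₐ[↥(maximalRealSubfield L)] L) : L →+* L) ((StdForm.antidiagonal 3).over L))
          ↥(unitaryGroupOfForm ((IsCMField.complexConj L : L ≃ₐ[↥(maximalRealSubfield L)] L) : L →+* L) ((StdForm.antidiagonal 3).over L))) =>
        ((borelHeight ((quasiSplit (↥(maximalRealSubfield L)) L (IsCMField.complexConj L) 3).toAdelic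
          (Quotient.out q : ↥(unitaryGroupOfForm ((IsCMField.complexConj L : L ≃ₐ[↥(maximalRealSubfield L)] L) : L →+* L) ((StdForm.antidiagonal 3).over L))) * g) : ℝ)) ^ τ :=
  summable_borelHeight_rpow_three (Algebra.IsQuadraticExtension.finrank_eq_two (↥(maximalRealSubfield L)) L) (AlgEquiv.ext fun x => IsCMField.complexConj_apply_apply L x) (IsCMField.complexConj_ne_one L)
    (exists_mem_borelAdelic_mul_mem_standardMaximalCompactGL_cm_three L) hτ

/-- **GODEMENT'S CRITERION FOR THE BOREL EISENSTEIN SERIES OF `U(2,1)` OVER A CM FIELD, UNCONDITIONAL.**  For `Re z > 2` (`z = s + 1`: `Re s > 1`) and any bounded coefficient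
`φ : U(J₃)(𝔸_{L⁺}) → ℂ` (`‖φ‖ ≤ M`), the series `E(f_z)(g) = Σ_{q ∈ B(L⁺)∖U(J₃)(L⁺)} φ(γ̃_q g) · H(γ̃_q g)^z = eisensteinSeriesU (flatSectionU φ z) g` converges ABSOLUTELY for every
`g`: `Summable (q ↦ ‖flatSectionU φ z (γ̃_q g)‖)`. [cite: Godement1964, §8] [cite: MoeglinWaldspurger1995, II.1.5] [cite: Garrett2018, §3.10 (Cor. 3.10.2)] [cite: Rogawski1990, §2.2] -/
theorem summable_eisensteinSeriesU_flatSectionU_cm_three {z : ℂ} (hz : 2 < z.re)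
    {φ : (quasiSplit (↥(maximalRealSubfield L)) L (IsCMField.complexConj L) 3).Adelic → ℂ} {M : ℝ} (hφ : ∀ x, ‖φ x‖ ≤ M)
    (g : (quasiSplit (↥(maximalRealSubfield L)) L (IsCMField.complexConj L) 3).Adelic) :
    Summable fun q : Quotient (orbitRel ↥(borelU ((IsCMField.complexConj L : L ≃ₐ[↥(maximalRealSubfield L)] L) : L →+* L) ((StdForm.antidiagonal 3).over L))
        ↥(unitaryGroupOfForm ((IsCMField.complexConj L : L ≃ₐ[↥(maximalRealSubfield L)] L) : L →+* L) ((StdForm.antidiagonal 3).over L))) =>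
      ‖flatSectionU φ z ((quasiSplit (↥(maximalRealSubfield L)) L (IsCMField.complexConj L) 3).toAdelic
          (Quotient.out q : ↥(unitaryGroupOfForm ((IsCMField.complexConj L : L ≃ₐ[↥(maximalRealSubfield L)] L) : L →+* L) ((StdForm.antidiagonal 3).over L))) * g)‖ :=
  summable_norm_flatSectionU_of_summable hφ (summable_borelHeight_rpow_cm_three L hz g)

/-- **THE LOCALLY UNIFORM MAJORANT, UNCONDITIONAL (R4a shape)**: for `Re z > 2` and `‖φ‖ ≤ M`, every `g₀ ∈ U(J₃)(𝔸_{L⁺})` has a neighbourhood `U` and a summable `u` with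
`‖flatSectionU φ z (γ̃_q * g)‖ ≤ u q` for all `g ∈ U` and all `q` — the input of ★ `K2E1EisensteinSeriesRegularity` (continuity of `g ↦ E(f_z)(g)`).
[cite: MoeglinWaldspurger1995, II.1.5] [cite: Garrett2018, §3.10 (Cor. 3.10.2)] -/
theorem exists_locallyUniform_majorant_flatSectionU_cm_three {z : ℂ} (hz : 2 < z.re)
    {φ : (quasiSplit (↥(maximalRealSubfield L)) L (IsCMField.complexConj L) 3).Adelic → ℂ} {M : ℝ} (hφ : ∀ x, ‖φ x‖ ≤ M)
    (g₀ : (quasiSplit (↥(maximalRealSubfield L)) L (IsCMField.complexConj L) 3).Adelic) :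
    ∃ U ∈ 𝓝 g₀, ∃ u : Quotient (orbitRel ↥(borelU ((IsCMField.complexConj L : L ≃ₐ[↥(maximalRealSubfield L)] L) : L →+* L) ((StdForm.antidiagonal 3).over L))
        ↥(unitaryGroupOfForm ((IsCMField.complexConj L : L ≃ₐ[↥(maximalRealSubfield L)] L) : L →+* L) ((StdForm.antidiagonal 3).over L))) → ℝ,
      Summable u ∧ ∀ g ∈ U, ∀ q,
        ‖flatSectionU φ z ((quasiSplit (↥(maximalRealSubfield L)) L (IsCMField.complexConj L) 3).toAdelic
          (Quotient.out q : ↥(unitaryGroupOfForm ((IsCMField.complexConj L : L ≃ₐ[↥(maximalRealSubfield L)] L) : L →+* L) ((StdForm.antidiagonal 3).over L))) * g)‖ ≤ u q := by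
  obtain ⟨U, hU, hmaj⟩ := exists_nhds_summable_majorant_borelHeight_rpow_three' (Algebra.IsQuadraticExtension.finrank_eq_two (↥(maximalRealSubfield L)) L)
    (AlgEquiv.ext fun x => IsCMField.complexConj_apply_apply L x) (IsCMField.complexConj_ne_one L) (exists_mem_borelAdelic_mul_mem_standardMaximalCompactGL_cm_three L) hz g₀
  exact ⟨U, hU, exists_majorant_flatSectionU_of_majorant hφ
    (y := fun q g => (quasiSplit (↥(maximalRealSubfield L)) L (IsCMField.complexConj L) 3).toAdelic
      (Quotient.out q : ↥(unitaryGroupOfForm ((IsCMField.complexConj L : L ≃ₐ[↥(maximalRealSubfield L)] L) : L →+* L) ((StdForm.antidiagonal 3).over L))) * g) hmaj⟩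

end CM

end Summit.HodgeConjecture.HodgeConjecture.Cruxes.H413.K2E1BorelEisensteinGodementCMThree

end
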